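import Mathlib
import Literature.Probability.Distributions.GaussianSphereMarginal
import HarnessLib

/-!
# Crux `EulerZoomLiouville.PowerGaugeEulerLiouville` (stmt-NavierStokesRegularity-19832), line `swirl-capacity`, stub D2 (log-sharp form) —
# tool 2: THE TWO-POLE LOGARITHMIC KERNEL BOUND IN THE PLANE

Route №10 `EulerZoomLiouville` (NavierStokesRegularity), crux E.  Line `swirl-capacity` (ideator ns-idea-11 g3;
`Cruxes/PowerGaugeEulerLiouville/Lines/swirl_capacity.lean`), registered stub `stub_axisCapacityFloor` (D2, the LOG-SHARP axis capacity
floor `∫_{B(0,3A)} |∇f|²/r² ≥ K γ₀² / (A (1 + log⁺(A³/V)))`).  The log-sharp proof is the planar LOGARITHMIC CAPACITY lower bound by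
potential duality: a ray representation `c |u(y)| ≤ ∫ ‖∇u(x)‖ / |x − y| dA(x)` integrated over the high set `S` and closed by Cauchy–Schwarz
needs `‖U_S‖²_{L²}` for the Newtonian potential `U_S(x) = ∫_S dA(y)/|x−y|`, i.e. the double integral over `S × S` of the TWO-POLE KERNEL
`K(y,y') = ∫_{|x| ≤ R} dA(x) / (|x − y| |x − y'|)`.  This file bounds that kernel with the logarithm intact (the tree's Carleman-type
two-pole estimate `Literature.Analysis.Complex.lintegral_inv_norm_sub_mul_inv_norm_sub_le` gives `8πR/|y − y'|`, which loses it):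

* `inv_mul_inv_le_onePole_add` — pointwise `1/(|x−y||x−y'|) ≤ g_d(|x−y|) + g_d(|x−y'|)`, `d = |y − y'|`, with the one-pole profile
  `g_d(s) = (2/d) s⁻¹` for `s < d/2`, `s⁻²` beyond (triangle inequality near a pole; `ab ≤ a² + b²` away from both);
* `lintegral_onePole_closedBall_le` — `∫_{|z| ≤ R'} g_d(|z|) dA ≤ 2π (1 + log (2R'/d))` (radial integration,
  `Literature.Probability.Distributions.lintegral_fun_norm_addHaar`);
* `twoPole_log_le` — **`K(y,y') ≤ 4π (1 + log (4R/|y − y'|))`** for `y ≠ y'` in the closed disc `|·| ≤ R`.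

The companion file `…SwirlCapacityPlaneLogKernel` integrates this over `S × S` by a layer-cake argument.
WHAT THIS IS NOT: not NS, not the crux, not D2 — a `--supports` tool for stmt-19832 (pure real analysis in the plane); no summit statement is
proved here.  [folklore]
-/

noncomputable section

-- flat `Theorems/<Route><Decl>…` files of one crux share the namespace of the crux (tree convention)
set_option linter.dupNamespace false

open MeasureTheory Set Filter Topology Metric Function Real
open scoped NNReal ENNReal

namespace Summit.NavierStokesRegularity.NavierStokesRegularity.Theorems.PowerGaugeEulerLiouville.SwirlCapacity

/-! ### The one-pole majorant -/

/-- The one-pole radial profile `g_d(s) = (2/d) s⁻¹` for `s < d/2`, `s⁻²` for `s ≥ d/2` (written out; no definition is introduced) is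
nonnegative for `d > 0`, `s ≥ 0`. [folklore] -/
theorem onePole_nonneg {d s : ℝ} (hd : 0 < d) (hs : 0 ≤ s) : 0 ≤ (if s < d / 2 then 2 / d * s⁻¹ else (s ^ 2)⁻¹) := by
  split_ifs
  · positivity
  · positivity

/-- **Pointwise two-pole majorant**: for `y ≠ y'`, `d = |y − y'|` and every `x`,
`|x−y|⁻¹ |x−y'|⁻¹ ≤ g_d(|x−y|) + g_d(|x−y'|)` — if `x` is within `d/2` of one pole it is at least `d/2` from the other (triangle
inequality), otherwise `ab ≤ a² + b²`. [folklore] -/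
theorem inv_mul_inv_le_onePole_add {x y y' : ℂ} (hne : y ≠ y') :
    ‖x - y‖⁻¹ * ‖x - y'‖⁻¹ ≤
      (if ‖x - y‖ < ‖y - y'‖ / 2 then 2 / ‖y - y'‖ * ‖x - y‖⁻¹ else (‖x - y‖ ^ 2)⁻¹) +
        (if ‖x - y'‖ < ‖y - y'‖ / 2 then 2 / ‖y - y'‖ * ‖x - y'‖⁻¹ else (‖x - y'‖ ^ 2)⁻¹) := by
  set d : ℝ := ‖y - y'‖ with hd
  set a : ℝ := ‖x - y‖ with ha
  set b : ℝ := ‖x - y'‖ with hb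
  have hd0 : 0 < d := norm_pos_iff.2 (sub_ne_zero.2 hne)
  have ha0 : 0 ≤ a := norm_nonneg _
  have hb0 : 0 ≤ b := norm_nonneg _
  have htri : d ≤ a + b := by
    calc d = ‖(x - y') - (x - y)‖ := by rw [hd]; congr 1; ring
      _ ≤ ‖x - y'‖ + ‖x - y‖ := norm_sub_le _ _
      _ = a + b := by rw [ha, hb, add_comm]
  have hga : 0 ≤ (if a < d / 2 then 2 / d * a⁻¹ else (a ^ 2)⁻¹) := onePole_nonneg hd0 ha0
  have hgb : 0 ≤ (if b < d / 2 then 2 / d * b⁻¹ else (b ^ 2)⁻¹) := onePole_nonneg hd0 hb0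
  by_cases h1 : a < d / 2
  · -- near the first pole
    have hb1 : d / 2 ≤ b := by linarith
    have hb2 : 0 < b := lt_of_lt_of_le (by linarith) hb1
    have hga' : (if a < d / 2 then 2 / d * a⁻¹ else (a ^ 2)⁻¹) = 2 / d * a⁻¹ := by rw [if_pos h1]
    calc a⁻¹ * b⁻¹ ≤ a⁻¹ * (d / 2)⁻¹ := by
          gcongr
      _ = (if a < d / 2 then 2 / d * a⁻¹ else (a ^ 2)⁻¹) := by rw [hga']; field_simp
      _ ≤ (if a < d / 2 then 2 / d * a⁻¹ else (a ^ 2)⁻¹) + (if b < d / 2 then 2 / d * b⁻¹ else (b ^ 2)⁻¹) := le_add_of_nonneg_right hgb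
  by_cases h2 : b < d / 2
  · -- near the second pole
    have ha1 : d / 2 ≤ a := by linarith
    have ha2 : 0 < a := lt_of_lt_of_le (by linarith) ha1
    have hgb' : (if b < d / 2 then 2 / d * b⁻¹ else (b ^ 2)⁻¹) = 2 / d * b⁻¹ := by rw [if_pos h2]
    calc a⁻¹ * b⁻¹ ≤ (d / 2)⁻¹ * b⁻¹ := by
          gcongr
      _ = (if b < d / 2 then 2 / d * b⁻¹ else (b ^ 2)⁻¹) := by rw [hgb']; field_simp
      _ ≤ (if a < d / 2 then 2 / d * a⁻¹ else (a ^ 2)⁻¹) + (if b < d / 2 then 2 / d * b⁻¹ else (b ^ 2)⁻¹) := le_add_of_nonneg_left hga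
  -- far from both poles
  have hga' : (if a < d / 2 then 2 / d * a⁻¹ else (a ^ 2)⁻¹) = (a ^ 2)⁻¹ := by rw [if_neg h1]
  have hgb' : (if b < d / 2 then 2 / d * b⁻¹ else (b ^ 2)⁻¹) = (b ^ 2)⁻¹ := by rw [if_neg h2]
  rw [hga', hgb']
  have ha2 : 0 < a := lt_of_lt_of_le (by linarith) (not_lt.1 h1)
  have hb2 : 0 < b := lt_of_lt_of_le (by linarith) (not_lt.1 h2)
  have key : a⁻¹ * b⁻¹ ≤ (a⁻¹) ^ 2 + (b⁻¹) ^ 2 := by nlinarith [sq_nonneg (a⁻¹ - b⁻¹), inv_pos.2 ha2, inv_pos.2 hb2]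
  simpa [inv_pow] using key

/-! ### Radial integration of the one-pole majorant -/

/-- The volume of the unit disc of `ℂ` is `π` (in `ℝ≥0∞`). [folklore] -/
theorem volume_ball_zero_one_complex : volume (ball (0 : ℂ) 1) = ENNReal.ofReal π := by
  rw [Complex.volume_ball, ENNReal.ofReal_one, one_pow, one_mul, ← ENNReal.ofReal_coe_nnreal, NNReal.coe_real_pi]

/-- **Radial integral of the one-pole majorant**: for `0 < d` and `d/2 ≤ R'`,
`∫_{|z| ≤ R'} g_d(|z|) dA(z) ≤ 2π (1 + log (2R'/d))` (`= 2π(∫_0^{d/2} (2/d) ds + ∫_{d/2}^{R'} ds/s)`). [folklore] -/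
theorem lintegral_onePole_closedBall_le {d R' : ℝ} (hd : 0 < d) (hdR : d / 2 ≤ R') :
    ∫⁻ z in closedBall (0 : ℂ) R', ENNReal.ofReal (if ‖z‖ < d / 2 then 2 / d * ‖z‖⁻¹ else (‖z‖ ^ 2)⁻¹) ≤
      ENNReal.ofReal (2 * π * (1 + Real.log (2 * R' / d))) := by
  have hd2 : 0 < d / 2 := by positivity
  have hR' : 0 < R' := lt_of_lt_of_le hd2 hdR
  -- the radial integrand
  set F : ℝ → ℝ≥0∞ := fun s => (Iic R').indicator (fun s => ENNReal.ofReal (if s < d / 2 then 2 / d * s⁻¹ else (s ^ 2)⁻¹)) s with hF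
  have hpm : Measurable fun s : ℝ => (if s < d / 2 then 2 / d * s⁻¹ else (s ^ 2)⁻¹) := by
    refine Measurable.ite measurableSet_Iio ?_ ?_
    · exact measurable_const.mul measurable_inv
    · exact (measurable_id.pow_const 2).inv
  have hFm : Measurable F := (ENNReal.measurable_ofReal.comp hpm).indicator measurableSet_Iic
  have hrad : ∫⁻ z in closedBall (0 : ℂ) R', ENNReal.ofReal (if ‖z‖ < d / 2 then 2 / d * ‖z‖⁻¹ else (‖z‖ ^ 2)⁻¹) = ∫⁻ z : ℂ, F ‖z‖ := by
    rw [← lintegral_indicator measurableSet_closedBall]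
    refine lintegral_congr fun z => ?_
    by_cases hz : z ∈ closedBall (0 : ℂ) R'
    · have hz' : ‖z‖ ∈ Iic R' := by simpa using hz
      rw [indicator_of_mem hz, hF]
      beta_reduce
      rw [indicator_of_mem hz']
    · have hz' : ‖z‖ ∉ Iic R' := by simpa using hz
      rw [indicator_of_notMem hz, hF]
      beta_reduce
      rw [indicator_of_notMem hz']
  rw [hrad, Literature.Probability.Distributions.lintegral_fun_norm_addHaar volume F hFm, Complex.finrank_real_complex,
    volume_ball_zero_one_complex]
  -- the one-dimensional integral
  set G : ℝ → ℝ≥0∞ := fun s => if s < d / 2 then ENNReal.ofReal (2 / d) else (Icc (d / 2) R').indicator (fun s => ENNReal.ofReal s⁻¹) s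
    with hG
  have hGF : ∀ s ∈ Ioi (0 : ℝ), ENNReal.ofReal (s ^ (2 - 1)) * F s = G s := by
    intro s hs
    have hs0 : 0 < s := hs
    simp only [show (2 : ℕ) - 1 = 1 from rfl, pow_one]
    by_cases h1 : s < d / 2
    · have hsR : s ∈ Iic R' := show s ≤ R' by linarith
      rw [hF, hG]
      beta_reduce
      rw [indicator_of_mem hsR]
      simp only [h1, if_true]
      rw [← ENNReal.ofReal_mul hs0.le]
      congr 1
      field_simp
    · rw [hG]
      beta_reduce
      simp only [h1, if_false]
      by_cases h2 : s ≤ R'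
      · have hsR : s ∈ Iic R' := h2
        have hsI : s ∈ Icc (d / 2) R' := ⟨not_lt.1 h1, h2⟩
        rw [hF]
        beta_reduce
        rw [indicator_of_mem hsR, indicator_of_mem hsI]
        simp only [h1, if_false]
        rw [← ENNReal.ofReal_mul hs0.le]
        congr 1
        field_simp
      · have hsR : s ∉ Iic R' := h2
        have hsI : s ∉ Icc (d / 2) R' := fun h => h2 h.2
        rw [hF]
        beta_reduce
        rw [indicator_of_notMem hsR, indicator_of_notMem hsI, mul_zero]
  rw [setLIntegral_congr_fun measurableSet_Ioi hGF]
  -- split `(0, ∞) = (0, d/2) ∪ [d/2, ∞)`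
  have hsplit : Ioi (0 : ℝ) = Ioo 0 (d / 2) ∪ Ici (d / 2) := by
    ext s
    simp only [mem_Ioi, mem_union, mem_Ioo, mem_Ici]
    constructor
    · intro hs
      rcases lt_or_ge s (d / 2) with h | h
      · exact Or.inl ⟨hs, h⟩
      · exact Or.inr h
    · rintro (⟨hs, _⟩ | hs)
      · exact hs
      · exact lt_of_lt_of_le hd2 hs
  have hdisj : Disjoint (Ioo 0 (d / 2)) (Ici (d / 2)) := by
    rw [Set.disjoint_left]
    intro s hs hs'
    exact (not_le.2 hs.2) hs'
  have h1 : ∫⁻ s in Ioo 0 (d / 2), G s = 1 := by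
    have : ∀ s ∈ Ioo 0 (d / 2), G s = ENNReal.ofReal (2 / d) := fun s hs => by rw [hG]; simp [hs.2]
    rw [setLIntegral_congr_fun measurableSet_Ioo this, setLIntegral_const, Real.volume_Ioo, sub_zero,
      ← ENNReal.ofReal_mul (by positivity)]
    rw [show 2 / d * (d / 2) = 1 by field_simp, ENNReal.ofReal_one]
  have h2 : ∫⁻ s in Ici (d / 2), G s = ENNReal.ofReal (Real.log (2 * R' / d)) := by
    have : ∀ s ∈ Ici (d / 2), G s = (Icc (d / 2) R').indicator (fun s => ENNReal.ofReal s⁻¹) s := fun s hs => by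
      rw [hG]; simp [not_lt.2 (show d / 2 ≤ s from hs)]
    rw [setLIntegral_congr_fun measurableSet_Ici this, lintegral_indicator measurableSet_Icc,
      Measure.restrict_restrict measurableSet_Icc, inter_eq_left.2 Icc_subset_Ici_self]
    have hint : IntegrableOn (fun s : ℝ => s⁻¹) (Icc (d / 2) R') volume := by
      refine ContinuousOn.integrableOn_Icc (continuousOn_inv₀.mono ?_)
      intro s hs
      exact ne_of_gt (lt_of_lt_of_le hd2 hs.1)
    rw [← ofReal_integral_eq_lintegral_ofReal hint]
    · rw [integral_Icc_eq_integral_Ioc, ← intervalIntegral.integral_of_le hdR, integral_inv_of_pos hd2 hR']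
      congr 2
      field_simp
    · refine ae_restrict_of_forall_mem measurableSet_Icc fun s hs => ?_
      exact inv_nonneg.2 (le_of_lt (lt_of_lt_of_le hd2 hs.1))
  rw [hsplit, lintegral_union measurableSet_Ici hdisj, h1, h2]
  -- arithmetic in `ℝ≥0∞`
  have hlog : 0 ≤ Real.log (2 * R' / d) := Real.log_nonneg (by rw [le_div_iff₀ hd]; linarith)
  rw [show ((2 : ℕ) : ℝ≥0∞) = ENNReal.ofReal 2 by simp, ← ENNReal.ofReal_one, ← ENNReal.ofReal_add zero_le_one hlog,
    ← ENNReal.ofReal_mul (by norm_num), ← ENNReal.ofReal_mul (by positivity)]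

/-- Translating the disc: for `|y| ≤ R`, `∫_{|x| ≤ R} g_d(|x − y|) dA(x) ≤ ∫_{|z| ≤ 2R} g_d(|z|) dA(z)`
(`B̄(0,R) ⊆ B̄(y, 2R)` and translation invariance). [folklore] -/
theorem lintegral_onePole_sub_le {d R : ℝ} {y : ℂ} (hy : ‖y‖ ≤ R) :
    ∫⁻ x in closedBall (0 : ℂ) R, ENNReal.ofReal (if ‖x - y‖ < d / 2 then 2 / d * ‖x - y‖⁻¹ else (‖x - y‖ ^ 2)⁻¹) ≤
      ∫⁻ z in closedBall (0 : ℂ) (2 * R), ENNReal.ofReal (if ‖z‖ < d / 2 then 2 / d * ‖z‖⁻¹ else (‖z‖ ^ 2)⁻¹) := by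
  have hsub : closedBall (0 : ℂ) R ⊆ closedBall y (2 * R) := fun x hx => by
    rw [mem_closedBall, dist_eq_norm]
    rw [mem_closedBall, dist_zero_right] at hx
    calc ‖x - y‖ ≤ ‖x‖ + ‖y‖ := norm_sub_le _ _
      _ ≤ R + R := add_le_add hx hy
      _ = 2 * R := by ring
  refine (lintegral_mono_set hsub).trans (le_of_eq ?_)
  rw [← lintegral_indicator measurableSet_closedBall, ← lintegral_indicator measurableSet_closedBall]
  have h : (closedBall y (2 * R)).indicator (fun x : ℂ => ENNReal.ofReal (if ‖x - y‖ < d / 2 then 2 / d * ‖x - y‖⁻¹ else (‖x - y‖ ^ 2)⁻¹)) =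
      fun x => (closedBall (0 : ℂ) (2 * R)).indicator (fun z => ENNReal.ofReal (if ‖z‖ < d / 2 then 2 / d * ‖z‖⁻¹ else (‖z‖ ^ 2)⁻¹)) (x - y) := by
    funext x
    have hiff : x ∈ closedBall y (2 * R) ↔ x - y ∈ closedBall (0 : ℂ) (2 * R) := by
      rw [mem_closedBall, dist_eq_norm, mem_closedBall, dist_zero_right]
    by_cases hx : x ∈ closedBall y (2 * R)
    · rw [indicator_of_mem hx, indicator_of_mem (hiff.1 hx)]
    · rw [indicator_of_notMem hx, indicator_of_notMem (fun h => hx (hiff.2 h))]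
  rw [h, lintegral_sub_right_eq_self
    (fun z => (closedBall (0 : ℂ) (2 * R)).indicator (fun z => ENNReal.ofReal (if ‖z‖ < d / 2 then 2 / d * ‖z‖⁻¹ else (‖z‖ ^ 2)⁻¹)) z) y]

/-- **THE TWO-POLE LOGARITHMIC KERNEL BOUND**: for `y ≠ y'` in the closed disc `|·| ≤ R`,
`∫_{|x| ≤ R} dA(x) / (|x−y| |x−y'|) ≤ 4π (1 + log (4R / |y − y'|))`. [folklore] -/
theorem twoPole_log_le {R : ℝ} {y y' : ℂ} (hy : ‖y‖ ≤ R) (hy' : ‖y'‖ ≤ R) (hne : y ≠ y') :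
    ∫⁻ x in closedBall (0 : ℂ) R, ENNReal.ofReal (‖x - y‖⁻¹ * ‖x - y'‖⁻¹) ≤
      ENNReal.ofReal (4 * π * (1 + Real.log (4 * R / ‖y - y'‖))) := by
  set d : ℝ := ‖y - y'‖ with hd
  have hd0 : 0 < d := norm_pos_iff.2 (sub_ne_zero.2 hne)
  have hdR : d ≤ 2 * R := by
    calc d ≤ ‖y‖ + ‖y'‖ := norm_sub_le _ _
      _ ≤ R + R := add_le_add hy hy'
      _ = 2 * R := by ring
  have hd2R : d / 2 ≤ 2 * R := by linarith
  have hone : ∀ w : ℂ, ‖w‖ ≤ R → ∫⁻ x in closedBall (0 : ℂ) R, ENNReal.ofReal (if ‖x - w‖ < d / 2 then 2 / d * ‖x - w‖⁻¹ else (‖x - w‖ ^ 2)⁻¹) ≤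
      ENNReal.ofReal (2 * π * (1 + Real.log (4 * R / d))) := by
    intro w hw
    refine (lintegral_onePole_sub_le hw).trans ?_
    have h := lintegral_onePole_closedBall_le hd0 hd2R
    rwa [show 2 * (2 * R) = 4 * R by ring] at h
  have hlog : 0 ≤ Real.log (4 * R / d) := Real.log_nonneg (by rw [le_div_iff₀ hd0]; linarith)
  calc ∫⁻ x in closedBall (0 : ℂ) R, ENNReal.ofReal (‖x - y‖⁻¹ * ‖x - y'‖⁻¹)
      ≤ ∫⁻ x in closedBall (0 : ℂ) R, ENNReal.ofReal (if ‖x - y‖ < d / 2 then 2 / d * ‖x - y‖⁻¹ else (‖x - y‖ ^ 2)⁻¹) +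
          ENNReal.ofReal (if ‖x - y'‖ < d / 2 then 2 / d * ‖x - y'‖⁻¹ else (‖x - y'‖ ^ 2)⁻¹) := by
        refine lintegral_mono fun x => ?_
        rw [← ENNReal.ofReal_add (onePole_nonneg hd0 (norm_nonneg _)) (onePole_nonneg hd0 (norm_nonneg _))]
        exact ENNReal.ofReal_le_ofReal (inv_mul_inv_le_onePole_add hne)
    _ = (∫⁻ x in closedBall (0 : ℂ) R, ENNReal.ofReal (if ‖x - y‖ < d / 2 then 2 / d * ‖x - y‖⁻¹ else (‖x - y‖ ^ 2)⁻¹)) +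
          ∫⁻ x in closedBall (0 : ℂ) R, ENNReal.ofReal (if ‖x - y'‖ < d / 2 then 2 / d * ‖x - y'‖⁻¹ else (‖x - y'‖ ^ 2)⁻¹) := by
        have hm : Measurable fun x : ℂ => ENNReal.ofReal (if ‖x - y‖ < d / 2 then 2 / d * ‖x - y‖⁻¹ else (‖x - y‖ ^ 2)⁻¹) := by
          have hpm : Measurable fun s : ℝ => (if s < d / 2 then 2 / d * s⁻¹ else (s ^ 2)⁻¹) := by
            refine Measurable.ite measurableSet_Iio ?_ ?_
            · exact measurable_const.mul measurable_inv
            · exact (measurable_id.pow_const 2).inv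
          exact ENNReal.measurable_ofReal.comp (hpm.comp (measurable_id.sub_const y).norm)
        exact lintegral_add_left hm _
    _ ≤ ENNReal.ofReal (2 * π * (1 + Real.log (4 * R / d))) + ENNReal.ofReal (2 * π * (1 + Real.log (4 * R / d))) :=
        add_le_add (hone y hy) (hone y' hy')
    _ = ENNReal.ofReal (4 * π * (1 + Real.log (4 * R / ‖y - y'‖))) := by
        rw [← ENNReal.ofReal_add (by positivity) (by positivity), ← hd]
        congr 1
        ring

end Summit.NavierStokesRegularity.NavierStokesRegularity.Theorems.PowerGaugeEulerLiouville.SwirlCapacity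

end
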